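import Mathlib
import HarnessLib
import Summits.NavierStokesRegularity.NavierStokesRegularity.Theorems.PoloidalWindowDoorPoloidalWindowRigidityUntwistedSeparation

/-!
# Route `PoloidalWindowDoor`, item `LrcModEntire` (stmt-NavierStokesRegularity-20428) / crux K2 (stmt-19708) — TWISTING STUBS
# (`stub_twistingTH`, `stub_twistingThick`; the K2 lead's `stub_twisting`): THE FRAME REDUCTION IN CARTESIAN FORM —
# on a twisting germ the horizontal velocity is ALGEBRAIC in the jets of `v₂`

Cell ns-regularity-ideate, seat ns-poloidal-K2-p3 (gen 6, LEAD of item 20428; `--supports stmt-NavierStokesRegularity-20428` helper toward the two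
registered twisting stubs of `Cruxes/LrcModEntire/Lines/twist_split.lean` v3).  Kernel form of `Cruxes/PoloidalWindowRigidity/UNTWISTED-NOTE.md` §5
(«handles on the twisting residue»: `β = (α_z − Λ√E)/γ`, `β_z = −αγ`) WITHOUT the orthonormal frame and its square roots, i.e. nsreg-p7 g11's first
elimination law C1 («the potential is eliminated in round 1», STRUCTURE-g11 §4) in invariant Cartesian currency.  Pure calculus on `ℝ³`; no
Navier–Stokes object appears.  Setting: `w : ℝ³ → ℝ` of class `C²` (the vertical velocity of one slice), `v₀, v₁ : ℝ³ → ℝ` differentiable (the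
horizontal velocity), an open `U`, and the SLOPE RELATION `∂₂v_b = Λ(w,y₂)·∂_b w` (`b = 0,1`) on `U` (tree: `…StructureFunctionNormalFormTwisting.normalForm_general`
provides it for class profiles near every non-degenerate point, twisting or not).  Notation (all functions of `y`):
`E = (∂₀w)² + (∂₁w)²`, the PAIRING `A = v₀∂₀w + v₁∂₁w = vₕ·∇ₕw`, the CO-PAIRING `B = v₁∂₀w − v₀∂₁w = vₕ·J∇ₕw`,
`a₁ = ∂₀w·∂₀(∂₂w) + ∂₁w·∂₁(∂₂w) = ∇ₕw·∇ₕ(∂₂w)`, and the TWIST `T = ∂₀(∂₂w)·∂₁w − ∂₁(∂₂w)·∂₀w` (the registered stubs' bracket).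

* `horizontal_decomposition` — `E·v₀ = A∂₀w − B∂₁w`, `E·v₁ = A∂₁w + B∂₀w` (algebra): `vₕ = (A∇ₕw + BJ∇ₕw)/E` where `∇ₕw ≠ 0`.
* `fderiv_vert_pairing` — **`∂₂A = Λ·E + v₀∂₀(∂₂w) + v₁∂₁(∂₂w)`** (slope relation + symmetry of second derivatives).
* `fderiv_vert_copairing` — **`∂₂B = v₁∂₀(∂₂w) − v₀∂₁(∂₂w)`** (the `Λ`-terms cancel).
* `twist_mul_copairing` — **`T·B = Λ·E² + A·a₁ − E·∂₂A`**: where the twist is non-zero the co-pairing — hence, with `A`, the WHOLE horizontal velocity —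
  is determined by `A`, `∂₂A` and the jets of `w` (UNTWISTED-NOTE §5 «β = (α_z − Λ√E)/γ»; p7's C1).  For class profiles `A` itself is given by the
  dynamic identity (V0) (`A = S − ∂ₜv₂`), so on a twisting germ `vₕ` is algebraic in the 3-jet of `v₂`, `∂ₜv₂` and the structure functions.
* `copairing_transport` — **`E·∂₂B = A·T + B·a₁`** (UNTWISTED-NOTE §5 «β_z = −αγ»): the second scalar law; with `twist_mul_copairing`, `curlₕvₕ = 0` and
  `divₕvₕ = −∂₂w` these are the «four scalar PDEs for one unknown» of the twisting residue.

WHAT THIS IS NOT: not a claim about Navier–Stokes regularity and not a proof of any twisting stub — the kinematic elimination of the horizontal velocity,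
for the provers / certificate engines of `stub_twistingTH` / `stub_twistingThick` / `stub_twisting` (bears_on LADDER-NS N0 via items 20428 / 19708).
-/

noncomputable section

-- the summit and its single sub-problem share the name (CONVENTIONS §1), as in every Theorems file
set_option linter.dupNamespace false

namespace Summit.NavierStokesRegularity.NavierStokesRegularity.Theorems.PoloidalWindowDoorLrcModEntireTwistingPairings

open Set Function Filter Topology Metric
open Summit.NavierStokesRegularity.NavierStokesRegularity.Theorems.PoloidalWindowDoorPoloidalWindowRigidityConstantShearMeans
open Summit.NavierStokesRegularity.NavierStokesRegularity.Theorems.PoloidalWindowDoorLrcModEntireLeafwiseVertical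
open Summit.NavierStokesRegularity.NavierStokesRegularity.Theorems.PoloidalWindowDoorPoloidalWindowRigidityUntwistedSeparation

variable {w v₀ v₁ : EuclideanSpace ℝ (Fin 3) → ℝ} {Λ : ℝ × ℝ → ℝ} {U : Set (EuclideanSpace ℝ (Fin 3))}

/-! ### Algebra: the horizontal velocity in the basis `(∇ₕw, J∇ₕw)` -/

/-- **`E·vₕ = A∇ₕw + B·J∇ₕw`** with `A = vₕ·∇ₕw`, `B = vₕ·J∇ₕw` (`J(a,b) = (−b,a)`): in components `E·v₀ = A∂₀w − B∂₁w`, `E·v₁ = A∂₁w + B∂₀w`.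
Pure algebra (any six reals). [folklore] -/
theorem horizontal_decomposition (p q a b : ℝ) :
    (p ^ 2 + q ^ 2) * a = (a * p + b * q) * p - (b * p - a * q) * q ∧
      (p ^ 2 + q ^ 2) * b = (a * p + b * q) * q + (b * p - a * q) * p := by
  constructor <;> ring

/-! ### The two vertical derivatives -/

/-- **`∂₂A = Λ·E + vₕ·∇ₕ(∂₂w)`** for the pairing `A = v₀∂₀w + v₁∂₁w`, under the slope relation `∂₂v_b = Λ(w,y₂)∂_b w` on the open `U`
(`w ∈ C²`, `v₀, v₁` differentiable; symmetry of second derivatives turns `∂₂∂_b w` into `∂_b∂₂w`). [folklore] -/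
theorem fderiv_vert_pairing (hw : ContDiff ℝ 2 w) (hv₀ : Differentiable ℝ v₀) (hv₁ : Differentiable ℝ v₁)
    (hΛ : ∀ y ∈ U, fderiv ℝ v₀ y (EuclideanSpace.single 2 (1 : ℝ)) = Λ (w y, y 2) * fderiv ℝ w y (EuclideanSpace.single 0 (1 : ℝ)) ∧
      fderiv ℝ v₁ y (EuclideanSpace.single 2 (1 : ℝ)) = Λ (w y, y 2) * fderiv ℝ w y (EuclideanSpace.single 1 (1 : ℝ)))
    {y : EuclideanSpace ℝ (Fin 3)} (hy : y ∈ U) :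
    fderiv ℝ (fun y' => v₀ y' * fderiv ℝ w y' (EuclideanSpace.single 0 (1 : ℝ)) + v₁ y' * fderiv ℝ w y' (EuclideanSpace.single 1 (1 : ℝ))) y
        (EuclideanSpace.single 2 (1 : ℝ)) =
      Λ (w y, y 2) * (fderiv ℝ w y (EuclideanSpace.single 0 (1 : ℝ)) ^ 2 + fderiv ℝ w y (EuclideanSpace.single 1 (1 : ℝ)) ^ 2) +
        (v₀ y * fderiv ℝ (fun y' => fderiv ℝ w y' (EuclideanSpace.single 2 (1 : ℝ))) y (EuclideanSpace.single 0 (1 : ℝ)) +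
          v₁ y * fderiv ℝ (fun y' => fderiv ℝ w y' (EuclideanSpace.single 2 (1 : ℝ))) y (EuclideanSpace.single 1 (1 : ℝ))) := by
  have hd := differentiableAt_partial hw
  have h0 : DifferentiableAt ℝ (fun y' => v₀ y' * fderiv ℝ w y' (EuclideanSpace.single 0 (1 : ℝ))) y := (hv₀ y).mul (hd _ y)
  have h1 : DifferentiableAt ℝ (fun y' => v₁ y' * fderiv ℝ w y' (EuclideanSpace.single 1 (1 : ℝ))) y := (hv₁ y).mul (hd _ y)
  rw [fderiv_fun_add h0 h1]
  simp only [_root_.add_apply]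
  rw [fderiv_mul_apply (hv₀ y) (hd _ y), fderiv_mul_apply (hv₁ y) (hd _ y),
    fderiv_fderiv_symm hw y (EuclideanSpace.single 0 (1 : ℝ)) (EuclideanSpace.single 2 (1 : ℝ)),
    fderiv_fderiv_symm hw y (EuclideanSpace.single 1 (1 : ℝ)) (EuclideanSpace.single 2 (1 : ℝ)), (hΛ y hy).1, (hΛ y hy).2]
  ring

/-- **`∂₂B = v₁∂₀(∂₂w) − v₀∂₁(∂₂w)`** for the co-pairing `B = v₁∂₀w − v₀∂₁w`, under the slope relation (the `Λ`-terms cancel). [folklore] -/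
theorem fderiv_vert_copairing (hw : ContDiff ℝ 2 w) (hv₀ : Differentiable ℝ v₀) (hv₁ : Differentiable ℝ v₁)
    (hΛ : ∀ y ∈ U, fderiv ℝ v₀ y (EuclideanSpace.single 2 (1 : ℝ)) = Λ (w y, y 2) * fderiv ℝ w y (EuclideanSpace.single 0 (1 : ℝ)) ∧
      fderiv ℝ v₁ y (EuclideanSpace.single 2 (1 : ℝ)) = Λ (w y, y 2) * fderiv ℝ w y (EuclideanSpace.single 1 (1 : ℝ)))
    {y : EuclideanSpace ℝ (Fin 3)} (hy : y ∈ U) :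
    fderiv ℝ (fun y' => v₁ y' * fderiv ℝ w y' (EuclideanSpace.single 0 (1 : ℝ)) - v₀ y' * fderiv ℝ w y' (EuclideanSpace.single 1 (1 : ℝ))) y
        (EuclideanSpace.single 2 (1 : ℝ)) =
      v₁ y * fderiv ℝ (fun y' => fderiv ℝ w y' (EuclideanSpace.single 2 (1 : ℝ))) y (EuclideanSpace.single 0 (1 : ℝ)) -
        v₀ y * fderiv ℝ (fun y' => fderiv ℝ w y' (EuclideanSpace.single 2 (1 : ℝ))) y (EuclideanSpace.single 1 (1 : ℝ)) := by
  have hd := differentiableAt_partial hw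
  have h1 : DifferentiableAt ℝ (fun y' => v₁ y' * fderiv ℝ w y' (EuclideanSpace.single 0 (1 : ℝ))) y := (hv₁ y).mul (hd _ y)
  have h0 : DifferentiableAt ℝ (fun y' => v₀ y' * fderiv ℝ w y' (EuclideanSpace.single 1 (1 : ℝ))) y := (hv₀ y).mul (hd _ y)
  rw [fderiv_fun_sub h1 h0]
  simp only [_root_.sub_apply]
  rw [fderiv_mul_apply (hv₁ y) (hd _ y), fderiv_mul_apply (hv₀ y) (hd _ y),
    fderiv_fderiv_symm hw y (EuclideanSpace.single 0 (1 : ℝ)) (EuclideanSpace.single 2 (1 : ℝ)),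
    fderiv_fderiv_symm hw y (EuclideanSpace.single 1 (1 : ℝ)) (EuclideanSpace.single 2 (1 : ℝ)), (hΛ y hy).1, (hΛ y hy).2]
  ring

/-! ### The two scalar laws of the twisting frame -/

/-- **`T·B = Λ·E² + A·a₁ − E·∂₂A`**: on a twisting germ (`T ≠ 0`) the co-pairing `B = vₕ·J∇ₕw`, hence with `A` the whole horizontal velocity
(`horizontal_decomposition`), is ALGEBRAIC in `A = vₕ·∇ₕw`, `∂₂A` and the jets of `w` (UNTWISTED-NOTE §5: `β = (α_z − Λ√E)/γ`).  Here
`T = ∂₀(∂₂w)∂₁w − ∂₁(∂₂w)∂₀w` and `a₁ = ∂₀w·∂₀(∂₂w) + ∂₁w·∂₁(∂₂w)`. [folklore] -/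
theorem twist_mul_copairing (hw : ContDiff ℝ 2 w) (hv₀ : Differentiable ℝ v₀) (hv₁ : Differentiable ℝ v₁)
    (hΛ : ∀ y ∈ U, fderiv ℝ v₀ y (EuclideanSpace.single 2 (1 : ℝ)) = Λ (w y, y 2) * fderiv ℝ w y (EuclideanSpace.single 0 (1 : ℝ)) ∧
      fderiv ℝ v₁ y (EuclideanSpace.single 2 (1 : ℝ)) = Λ (w y, y 2) * fderiv ℝ w y (EuclideanSpace.single 1 (1 : ℝ)))
    {y : EuclideanSpace ℝ (Fin 3)} (hy : y ∈ U) :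
    (fderiv ℝ (fun y' => fderiv ℝ w y' (EuclideanSpace.single 2 (1 : ℝ))) y (EuclideanSpace.single 0 (1 : ℝ)) * fderiv ℝ w y (EuclideanSpace.single 1 (1 : ℝ)) -
        fderiv ℝ (fun y' => fderiv ℝ w y' (EuclideanSpace.single 2 (1 : ℝ))) y (EuclideanSpace.single 1 (1 : ℝ)) * fderiv ℝ w y (EuclideanSpace.single 0 (1 : ℝ))) *
        (v₁ y * fderiv ℝ w y (EuclideanSpace.single 0 (1 : ℝ)) - v₀ y * fderiv ℝ w y (EuclideanSpace.single 1 (1 : ℝ))) =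
      Λ (w y, y 2) * (fderiv ℝ w y (EuclideanSpace.single 0 (1 : ℝ)) ^ 2 + fderiv ℝ w y (EuclideanSpace.single 1 (1 : ℝ)) ^ 2) ^ 2 +
        (v₀ y * fderiv ℝ w y (EuclideanSpace.single 0 (1 : ℝ)) + v₁ y * fderiv ℝ w y (EuclideanSpace.single 1 (1 : ℝ))) *
          (fderiv ℝ w y (EuclideanSpace.single 0 (1 : ℝ)) * fderiv ℝ (fun y' => fderiv ℝ w y' (EuclideanSpace.single 2 (1 : ℝ))) y (EuclideanSpace.single 0 (1 : ℝ)) +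
            fderiv ℝ w y (EuclideanSpace.single 1 (1 : ℝ)) * fderiv ℝ (fun y' => fderiv ℝ w y' (EuclideanSpace.single 2 (1 : ℝ))) y (EuclideanSpace.single 1 (1 : ℝ))) -
        (fderiv ℝ w y (EuclideanSpace.single 0 (1 : ℝ)) ^ 2 + fderiv ℝ w y (EuclideanSpace.single 1 (1 : ℝ)) ^ 2) *
          fderiv ℝ (fun y' => v₀ y' * fderiv ℝ w y' (EuclideanSpace.single 0 (1 : ℝ)) + v₁ y' * fderiv ℝ w y' (EuclideanSpace.single 1 (1 : ℝ))) y
            (EuclideanSpace.single 2 (1 : ℝ)) := by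
  rw [fderiv_vert_pairing hw hv₀ hv₁ hΛ hy]
  ring

/-- **`E·∂₂B = A·T + B·a₁`** (UNTWISTED-NOTE §5: `β_z = −αγ`): the transport of the co-pairing along the height.  Together with `twist_mul_copairing`,
`curlₕvₕ = 0` and `divₕvₕ = −∂₂w`, this is the overdetermined «four scalar PDEs for one unknown `v₂`» form of the twisting residue. [folklore] -/
theorem copairing_transport (hw : ContDiff ℝ 2 w) (hv₀ : Differentiable ℝ v₀) (hv₁ : Differentiable ℝ v₁)
    (hΛ : ∀ y ∈ U, fderiv ℝ v₀ y (EuclideanSpace.single 2 (1 : ℝ)) = Λ (w y, y 2) * fderiv ℝ w y (EuclideanSpace.single 0 (1 : ℝ)) ∧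
      fderiv ℝ v₁ y (EuclideanSpace.single 2 (1 : ℝ)) = Λ (w y, y 2) * fderiv ℝ w y (EuclideanSpace.single 1 (1 : ℝ)))
    {y : EuclideanSpace ℝ (Fin 3)} (hy : y ∈ U) :
    (fderiv ℝ w y (EuclideanSpace.single 0 (1 : ℝ)) ^ 2 + fderiv ℝ w y (EuclideanSpace.single 1 (1 : ℝ)) ^ 2) *
        fderiv ℝ (fun y' => v₁ y' * fderiv ℝ w y' (EuclideanSpace.single 0 (1 : ℝ)) - v₀ y' * fderiv ℝ w y' (EuclideanSpace.single 1 (1 : ℝ))) y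
          (EuclideanSpace.single 2 (1 : ℝ)) =
      (v₀ y * fderiv ℝ w y (EuclideanSpace.single 0 (1 : ℝ)) + v₁ y * fderiv ℝ w y (EuclideanSpace.single 1 (1 : ℝ))) *
          (fderiv ℝ (fun y' => fderiv ℝ w y' (EuclideanSpace.single 2 (1 : ℝ))) y (EuclideanSpace.single 0 (1 : ℝ)) * fderiv ℝ w y (EuclideanSpace.single 1 (1 : ℝ)) -
            fderiv ℝ (fun y' => fderiv ℝ w y' (EuclideanSpace.single 2 (1 : ℝ))) y (EuclideanSpace.single 1 (1 : ℝ)) * fderiv ℝ w y (EuclideanSpace.single 0 (1 : ℝ))) +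
        (v₁ y * fderiv ℝ w y (EuclideanSpace.single 0 (1 : ℝ)) - v₀ y * fderiv ℝ w y (EuclideanSpace.single 1 (1 : ℝ))) *
          (fderiv ℝ w y (EuclideanSpace.single 0 (1 : ℝ)) * fderiv ℝ (fun y' => fderiv ℝ w y' (EuclideanSpace.single 2 (1 : ℝ))) y (EuclideanSpace.single 0 (1 : ℝ)) +
            fderiv ℝ w y (EuclideanSpace.single 1 (1 : ℝ)) * fderiv ℝ (fun y' => fderiv ℝ w y' (EuclideanSpace.single 2 (1 : ℝ))) y (EuclideanSpace.single 1 (1 : ℝ))) := by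
  rw [fderiv_vert_copairing hw hv₀ hv₁ hΛ hy]
  ring

end Summit.NavierStokesRegularity.NavierStokesRegularity.Theorems.PoloidalWindowDoorLrcModEntireTwistingPairings

end
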